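import Summits.Langlands.Langlands.Theses.OrdinaryPrimeTransport
import Literature.NumberTheory.DiophantineGeometry.BcgpSwitchingSurface
import Literature.NumberTheory.DiophantineGeometry.AbelianVarietyOrdinaryReduction
import Literature.NumberTheory.GaloisRepresentations.OrdinaryPDistinguished
import Literature.NumberTheory.Automorphic.IsAutomorphicAE
import HarnessLib

/-!
# F3 `_special` — the floor `d = 1` IS the family member (line `RealQuadraticBigImageAbelianSurface`, crux
`ReciprocityUpToIrreducibility`, item stmt-Langlands-14328; G4 ladder-down generation 32)

`floor_one : FloorText → BigImageOrdinaryAbelianSurfaceTR 1` (BCGP 2025 Thm. 1, arXiv:2502.20645 p. 3, as the text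
hypothesis `FloorText` — the theorem is in print and not yet vendored in the tree), `family_zero` (no field of degree
`0`), `family_of` (every member from floor text + rung + gap).  Sorry-free.  Definitions verbatim from
`Lines/RealQuadraticBigImageAbelianSurface.lean` §1–2.
-/

set_option autoImplicit false

noncomputable section

open scoped MatrixGroups Matrix NumberField Classical
open Filter IsDedekindDomain IsDedekindDomain.HeightOneSpectrum CategoryTheory
open Literature.NumberTheory.Automorphic Literature.NumberTheory.GaloisRepresentations
open Literature.NumberTheory.PAdicHodge Literature.NumberTheory.DiophantineGeometry
open Literature.AlgebraicGeometry.Motives (AbelianVariety)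
open NumberField
open Summit.Langlands

namespace Summit.Langlands.Langlands.Cruxes.ReciprocityUpToIrreducibility.RealQuadraticBigImageAbelianSurface

/-! ## 1. The hypotheses of BCGP 2025 Thm. 1 over a number field `F`, place-wise; the modularity conclusion -/

/-- **The three hypotheses of Boxer–Calegari–Gee–Pilloni 2025, Thm. 1 (= Thm. 9.5.3 with surjective image), for an
abelian surface `A` over a number field `F`, stated place-wise** (so that `F = ℚ` is the printed theorem and any totally
real `F` is a member of the dial).
(1) "polarization of degree prime to `3`" + "`ρ̄_{A,3} : G_F → GSp₄(𝔽₃)` surjective": a contragredient additive frame `e₃`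
of `A[3](F̄)` in which `Γ_F` acts through `ρb : Γ_F → GL₄(𝔽₃)` (the clause of the tree fact
`bcgp_switchingSurface_exists` (2)(a), verbatim with `F` for `ℚ`), an alternating unit-determinant `J` with
`ρb(g)ᵀ J ρb(g) = ε̄₃(g)⁻¹ J` (the tree's `IsSymplecticWithMultiplierFun` unfolded, multiplier the inverse mod-`3`
cyclotomic character — exactly how the accepted tree fact `bcgp_switch_exists_modular_abelianSurface` renders the
polarization-induced symplectic structure that the proof of Thm. 9.5.3 uses, via Lemma 9.4.2), and EVERY similitude
of `J` in the image of `ρb` (surjectivity onto `GSp(J) = GSp₄(𝔽₃)`);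
(2) at every `v ∣ 2`: `ρb` unramified at `v` and `charpoly ρb(Frob_v) ≠ (X² ± X + 2)²` (verbatim the third hypothesis
of the tree's switch facts);
(3) at every `v ∣ 3`: good ordinary reduction (tree `HasGoodOrdinaryReductionAt`) and every framed dual `r₃` of `V₃(A)`
ordinary and `3`-distinguished at `v` (tree `IsOrdinaryPDistinguishedAt`, BCGP Def. 1.8.8; for good ordinary reduction
this is "the characteristic polynomial of Frobenius at `3` has distinct roots" of Thm. 1 (3)).
[cite: BoxerCalegariGeePilloni2025, Thm. 1 (p. 3), Thm. 9.5.3 and its proof (pp. 136–137), Lemma 9.4.2, Def. 1.8.8, §1.8.11 (arXiv:2502.20645)] -/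
def IsBigImageOrdinaryAtThree (F : Type) [Field F] [NumberField F] (A : AbelianVariety F) : Prop :=
  (∃ (ρb : FramedGaloisRep F (ZMod 3) 4) (e₃ : A.geomTorsion (3 : ℕ) ≃+ (Fin 4 → ZMod 3))
      (J : Matrix (Fin 4) (Fin 4) (ZMod 3)),
      (∀ (g : Field.absoluteGaloisGroup F) (P : A.geomTorsion (3 : ℕ)),
          e₃ (g • P) = ((ρb g⁻¹ : GL (Fin 4) (ZMod 3)) : Matrix (Fin 4) (Fin 4) (ZMod 3))ᵀ *ᵥ e₃ P) ∧
      Jᵀ = -J ∧ IsUnit J.det ∧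
      (∀ g : Field.absoluteGaloisGroup F,
          (ρb g).valᵀ * J * (ρb g).val =
            (((modPCyclotomicCharacterZMod F 3 g)⁻¹ : (ZMod 3)ˣ) : ZMod 3) • J) ∧
      (∀ M : GL (Fin 4) (ZMod 3),
          (∃ c : ZMod 3, IsUnit c ∧ M.valᵀ * J * M.val = c • J) →
            ∃ g : Field.absoluteGaloisGroup F, ρb g = M) ∧
      (∀ v : HeightOneSpectrum (𝓞 F), ((2 : ℕ) : 𝓞 F) ∈ v.asIdeal →
          ρb.IsUnramifiedAt v ∧
            ∀ Q : Polynomial (ZMod 3), ρb.HasFrobCharpolyAt v Q →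
              Q ≠ (Polynomial.X ^ 2 + Polynomial.X + 2) ^ 2 ∧
                Q ≠ (Polynomial.X ^ 2 - Polynomial.X + 2) ^ 2)) ∧
  (∀ v : HeightOneSpectrum (𝓞 F), ((3 : ℕ) : 𝓞 F) ∈ v.asIdeal → A.HasGoodOrdinaryReductionAt v) ∧
  (∀ (b₃ : Module.Basis (Fin 4) ℚ_[3] (A.rationalTateModule 3)) (r₃ : FramedGaloisRep F (PadicAlgCl 3) 4),
      (∀ g : Field.absoluteGaloisGroup F,
        (r₃ g).val =
          ((LinearMap.toMatrix b₃ b₃ (A.rationalTateRep 3 g⁻¹)).map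
            (algebraMap ℚ_[3] (PadicAlgCl 3))).transpose) →
      ∀ v : HeightOneSpectrum (𝓞 F), ((3 : ℕ) : 𝓞 F) ∈ v.asIdeal → r₃.IsOrdinaryPDistinguishedAt v)

/-- **"`A` is modular" in the summit's `GL₄` a.e.-Satake form** (as in line `A5bTwoRankOne`, with `F` for `ℚ`): for every
prime `ℓ`, every framed dual `r` of `V_ℓ(A)` (frame clause `r(g) = [g⁻¹]_bᵀ`) which is irreducible, unramified a.e. and
de Rham above `ℓ` for Fontaine's pinned datum (three TRUE extra hypotheses — Faltings + big image, Néron–Ogg–Shafarevich,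
Fontaine–Faltings — so that clause (B) of E applies to `r` literally), every level structure `hcpt` and every
`ι : ℚ̄_ℓ ≃ ℂ`, some automorphic representation of `GL₄(𝔸_F)` has Satake parameters giving `det(X − r(Frob_v))` at almost
every `v` (`SatakeFrobCompatibleAE`). -/
def IsModularGL4 (F : Type) [Field F] [NumberField F] (A : AbelianVariety F) : Prop :=
  ∀ (ℓ : ℕ) [Fact ℓ.Prime] (b : Module.Basis (Fin 4) ℚ_[ℓ] (A.rationalTateModule ℓ))
    (r : FramedGaloisRep F (PadicAlgCl ℓ) 4),
    (∀ g : Field.absoluteGaloisGroup F,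
      (r g).val =
        ((LinearMap.toMatrix b b (A.rationalTateRep ℓ g⁻¹)).map
          (algebraMap ℚ_[ℓ] (PadicAlgCl ℓ))).transpose) →
    r.toGaloisRep.IsIrreducible →
    (∀ᶠ v : HeightOneSpectrum (𝓞 F) in cofinite, r.IsUnramifiedAt v) →
    (∀ (w : HeightOneSpectrum (𝓞 F)) (hw : ((ℓ : ℕ) : 𝓞 F) ∈ w.asIdeal),
        (fontainePstAdicCompletion w ℓ hw).IsDeRhamFramed (r.toLocal w)) →
    ∀ (hcpt : isCompact_glFiniteIntegralLevel 4 F) (ι : PadicAlgCl ℓ ≃+* ℂ),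
      ∃ π : AutomorphicRepData (AutomorphyDatum.gl 4 F hcpt), SatakeFrobCompatibleAE ι π r

/-! ## 2. The dial `d = [F:ℚ]`, the rung `d = 2`, the gap above, the floor text `d = 1` -/

/-- **The RUNG FAMILY, dial = the degree `d = [F:ℚ]` of the totally real base field**: every abelian surface over a
totally real field of degree `d` satisfying the three hypotheses of BCGP 2025 Thm. 1 at all places above `2` and `3`
is modular (`GL₄(𝔸_F)`, a.e.-Satake form). -/
def BigImageOrdinaryAbelianSurfaceTR (d : ℕ) : Prop :=
  ∀ (F : Type) [Field F] [NumberField F] [IsTotallyReal F], Module.finrank ℚ F = d →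
    ∀ A : AbelianVariety F, A.dim = 2 → IsBigImageOrdinaryAtThree F A → IsModularGL4 F A

/-- **THE RUNG (θ32 = 2)**: abelian surfaces over REAL QUADRATIC fields with `ρ̄_{A,3}(Γ_F) = GSp₄(𝔽₃)` (polarization
prime to `3`), `ρ̄_{A,3}` unramified with Frobenius characteristic polynomial `≠ (X² ± X + 2)²` at every `v ∣ 2`, and
good ordinary `3`-distinguished reduction at every `v ∣ 3`, are modular.  OPEN: the generalisation of BCGP 2025 Thm. 1
to totally real fields is announced as future work requiring "new ideas" for the classicality theorem
(arXiv:2502.20645 p. 3; Gee, arXiv:2510.02756 §6). -/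
def RealQuadraticBigImageAbelianSurface : Prop := BigImageOrdinaryAbelianSurfaceTR 2

/-- **Above the rung (θ32 ≥ 3)**: the same over totally real fields of every degree `≥ 3`. -/
def HigherDegreeBigImageAbelianSurface : Prop := ∀ d : ℕ, 3 ≤ d → BigImageOrdinaryAbelianSurfaceTR d

/-- **Floor text** (obligation node, in print, not yet vendored in the tree): Boxer–Calegari–Gee–Pilloni 2025 Thm. 1
(arXiv:2502.20645, p. 3; = Thm. 9.5.3 with `ρ̄_{A,3}` surjective, proof pp. 136–137: the `2`–`3` switch Lemma 9.4.2 +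
the `3`-adic lifting Thm. 9.5.1 + transfer `GSp₄ → GL₄`, §1.8.10–1.8.12) for abelian surfaces over a number field of
degree `1` (= `ℚ`), hypotheses exactly `IsBigImageOrdinaryAtThree`, conclusion "`A` is modular: a cuspidal `π` on
`GL₄/ℚ` with `L(s, H¹(A)) = L(s, π)`" in the almost-everywhere L-normalised currency of the tree's switch fact
`bcgp_switch_exists_modular_abelianSurface` (for every `ℓ`, frame `b`, framed dual `r` of `V_ℓ(A)`, `hcpt`, `ι`: an
`L`-algebraic cuspidal `π` of `GL₄(𝔸)` whose Satake parameters give `det(X − r(Frob_v))` at almost every `v`).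
[cite: BoxerCalegariGeePilloni2025, Thm. 1, Thm. 9.5.3, Thm. 9.5.1, Lemma 9.4.2, §1.8.10–1.8.12 (arXiv:2502.20645)] -/
def FloorText : Prop :=
  ∀ (F : Type) [Field F] [NumberField F] [IsTotallyReal F], Module.finrank ℚ F = 1 →
    ∀ A : AbelianVariety F, A.dim = 2 → IsBigImageOrdinaryAtThree F A →
      ∀ (ℓ : ℕ) [Fact ℓ.Prime] (b : Module.Basis (Fin 4) ℚ_[ℓ] (A.rationalTateModule ℓ))
        (r : FramedGaloisRep F (PadicAlgCl ℓ) 4),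
        (∀ g : Field.absoluteGaloisGroup F,
          (r g).val =
            ((LinearMap.toMatrix b b (A.rationalTateRep ℓ g⁻¹)).map
              (algebraMap ℚ_[ℓ] (PadicAlgCl ℓ))).transpose) →
        ∀ (hcpt : isCompact_glFiniteIntegralLevel 4 F) (ι : PadicAlgCl ℓ ≃+* ℂ),
          ∃ π : CuspidalAutomorphicRepData 4 F hcpt, π.1.IsLAlgebraic ∧
            ∀ᶠ v : HeightOneSpectrum (𝓞 F) in cofinite, ∃ a : Multiset ℂ,
              π.1.HasSatakeParamAt v a ∧ r.IsUnramifiedAt v ∧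
                r.HasFrobCharpolyAt v (arithFrobPolyOfSatake ι v.residueCard 1 a)

/-! ## The floor member and the vacuous member, sorry-free -/

/-- **F3: the family at `d = 1` from the floor text** (BCGP 2025 Thm. 1): the irreducibility, ramification and de Rham
hypotheses of the member are discarded and the cuspidal `π` is read as an automorphic representation. -/
theorem floor_one (h : FloorText) : BigImageOrdinaryAbelianSurfaceTR 1 := by
  intro F _ _ _ hdeg A hdim hA ℓ _ b r hfr _hirr _hunr _hdR hcpt ι
  obtain ⟨π, -, hπ⟩ := h F hdeg A hdim hA ℓ b r hfr hcpt ι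
  exact ⟨π.1, hπ⟩

/-- No number field has degree `0`: the member `d = 0` is vacuous. [folklore] -/
theorem family_zero : BigImageOrdinaryAbelianSurfaceTR 0 := by
  intro F _ _ _ hdeg
  exact absurd hdeg (Module.finrank_pos (R := ℚ) (M := F)).ne'

/-- **Every member** from the floor text, the rung and the higher-degree gap. -/
theorem family_of (h1 : FloorText) (h2 : RealQuadraticBigImageAbelianSurface)
    (h3 : HigherDegreeBigImageAbelianSurface) (d : ℕ) : BigImageOrdinaryAbelianSurfaceTR d := by
  rcases Nat.lt_or_ge d 3 with h | h
  · interval_cases d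
    · exact family_zero
    · exact floor_one h1
    · exact h2
  · exact h3 d h

end Summit.Langlands.Langlands.Cruxes.ReciprocityUpToIrreducibility.RealQuadraticBigImageAbelianSurface

end
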